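import Literature.NumberTheory.CubicFields.CubicFieldDiscriminant18251
import HarnessLib

/-!
# The cubic field of discriminant `−18251` (LMFDB 3.1.18251.1), part 2: the primes above `p ≤ 13` of norm `≤ 38` are principal — PROVED

Sequel of `CubicFieldDiscriminant18251.lean` (same seat bsd-line-att-p4 g44, same namespace `Literature.NumberTheory.CubicFields.CubicDisc18251`; part 1:
`f`, `g`, `𝓞_F = ℤ ⊕ ℤθ ⊕ ℤδ`, the Dedekind–Kummer exponents, `d_F = −18251`, signature).  THEOREMS ONLY; every statement PROVED.
§3 (first half, split for the 400-line rule): every prime of `𝓞_F` above `p ≤ 13` with `p^f ≤ 38` is principal — Dedekind–Kummer through `θ` (`p ≠ 7`) or `δ`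
(`p = 7`) and EXPLICIT GENERATORS in `ℤ ⊕ ℤθ ⊕ ℤδ` (norm-form search on the LLL-reduced integral basis, pure Python): `(2, θ) = (−20 + 3θ − 5δ)` (norm `−2`:
the degree-one dyadic prime `𝔭₁` of the cell's `2`-adic doors IS principal), `(2, θ² + θ + 1) = (381 + 56θ + 23δ)` (norm `4`), `3`, `5`, `11` inert,
`(7, δ + 4) = (−69 + 5θ + δ)`, `(13, θ) = (−13 + θ)`, `(13, θ + 11) = (−49 + 2θ + 6δ)`, `(13, θ + 1) = (−29 − θ + 11δ)` (`13` splits completely); the degree-two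
prime above `7` has norm `49 > 38`.  Each ideal identity is two memberships and one pair-membership, checked in `F` by `linear_combination` against `f(α) = 0`
with `δ = (α² − 5α − 78)/7`.  Part 3 (`…ClassNumber`): `p = 17 … 37` and ★ `h_F = 1`.
Written for the rank-`0` u7 seed `[1, 0, 0, −40, −101]` (conductor `18251`) of crux C2's census (cell `bsd-f1-sign2`, route `AlignedTransportAtTwo`).

References: [LMFDB] number field 3.1.18251.1 (class number 1); [Marcus2018] Ch. 3 Thm. 27.
-/

noncomputable section

open Polynomial NumberField NumberField.InfinitePlace Ideal Module Real
open Literature.NumberTheory.NumberFields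
open Literature.NumberTheory.NumberFields.MonicCubic

namespace Literature.NumberTheory.CubicFields.CubicDisc18251

section NumberField

variable {F : Type*} [Field F] [NumberField F] {α : F}

/-! ## §3 The primes of norm `≤ 38` are principal: `p ≤ 13` -/

/-- `(2, θ) = (-20 + 3 * θ - 5 * δ)`, an element of norm `-2` (identities checked in `F`, `δ = (α ^ 2 - 5 * α - 78) / 7`).
[cite: Marcus2018, Ch. 3, Thm. 27] -/
theorem span_2_lin0_eq (hα : aeval α (poly (-1) (-119) (-494)) = 0) :
    span {(2 : 𝓞 F), thetaInt hα} = span {-20 + 3 * thetaInt hα - 5 * thetaInt (delta_root hα)} := by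
  apply le_antisymm
  · rw [span_le]
    rintro x hx
    rcases hx with rfl | hx
    · exact mem_span_singleton'.mpr ⟨-381 - 56 * thetaInt hα - 23 * thetaInt (delta_root hα), by
          rw [RingOfIntegers.ext_iff]
          simp only [map_mul, map_add, map_sub, map_neg, map_ofNat, MonicCubic.thetaInt, RingOfIntegers.map_mk]
          linear_combination (((442 : F) / 49) + ((115 : F) / 49) * α) * cubic_eq hα⟩
    · rw [Set.mem_singleton_iff.mp hx]
      exact mem_span_singleton'.mpr ⟨-2483 - 365 * thetaInt hα - 150 * thetaInt (delta_root hα), by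
          rw [RingOfIntegers.ext_iff]
          simp only [map_mul, map_add, map_sub, map_neg, map_ofNat, MonicCubic.thetaInt, RingOfIntegers.map_mk]
          linear_combination (((2875 : F) / 49) + ((750 : F) / 49) * α) * cubic_eq hα⟩
  · rw [span_singleton_le_iff_mem, mem_span_pair]
    exact ⟨185 + 15 * thetaInt (delta_root hα), 28 - 5 * thetaInt hα, by
        rw [RingOfIntegers.ext_iff]
        simp only [map_mul, map_add, map_sub, map_neg, map_ofNat, MonicCubic.thetaInt, RingOfIntegers.map_mk]
        linear_combination (0 : F) * cubic_eq hα⟩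

/-- `(2, θ ^ 2 + θ + 1) = (381 + 56 * θ + 23 * δ)`, an element of norm `4` (identities checked in `F`, `δ = (α ^ 2 - 5 * α - 78) / 7`).
[cite: Marcus2018, Ch. 3, Thm. 27] -/
theorem span_2_quad_eq (hα : aeval α (poly (-1) (-119) (-494)) = 0) :
    span {(2 : 𝓞 F), thetaInt hα ^ 2 + thetaInt hα + 1} = span {381 + 56 * thetaInt hα + 23 * thetaInt (delta_root hα)} := by
  apply le_antisymm
  · rw [span_le]
    rintro x hx
    rcases hx with rfl | hx
    · exact mem_span_singleton'.mpr ⟨20 - 3 * thetaInt hα + 5 * thetaInt (delta_root hα), by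
          rw [RingOfIntegers.ext_iff]
          simp only [map_mul, map_add, map_sub, map_ofNat, MonicCubic.thetaInt, RingOfIntegers.map_mk]
          linear_combination (((442 : F) / 49) + ((115 : F) / 49) * α) * cubic_eq hα⟩
    · rw [Set.mem_singleton_iff.mp hx]
      exact mem_span_singleton'.mpr ⟨205 - 55 * thetaInt hα + 134 * thetaInt (delta_root hα), by
          rw [RingOfIntegers.ext_iff]
          simp only [map_mul, map_add, map_sub, map_pow, map_ofNat, map_one, MonicCubic.thetaInt, RingOfIntegers.map_mk]
          linear_combination (((15935 : F) / 49) + ((3082 : F) / 49) * α) * cubic_eq hα⟩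
  · rw [span_singleton_le_iff_mem, mem_span_pair]
    exact ⟨-14859 - 1115 * thetaInt hα - 1322 * thetaInt (delta_root hα), 381, by
        rw [RingOfIntegers.ext_iff]
        simp only [map_mul, map_add, map_sub, map_neg, map_pow, map_ofNat, map_one, MonicCubic.thetaInt, RingOfIntegers.map_mk]
        linear_combination (0 : F) * cubic_eq hα⟩

/-- **Every prime of `𝓞_F` above `2` is principal** (Dedekind–Kummer through `θ`, `2 ∤ exponent`, with `polyMod_2` and the generators above).
[cite: Marcus2018, Ch. 3, Thm. 27] [cite: LMFDB, number field 3.1.18251.1 (class number 1)] -/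
theorem isPrincipal_of_mem_primesOver_2 (h3 : finrank ℚ F = 3) (hα : aeval α (poly (-1) (-119) (-494)) = 0) {P : Ideal (𝓞 F)}
    (hP : P ∈ primesOver (span {((2 : ℕ) : ℤ)}) (𝓞 F)) : Submodule.IsPrincipal P := by
  haveI : Fact (Nat.Prime 2) := ⟨by norm_num⟩
  obtain ⟨Qb, hirr, hmon, hdvd, -, hspan⟩ :=
    exists_factor_of_mem_primesOver' irreducible_polyQ hα (by norm_num : Nat.Prime 2)
      (not_dvd_exponent h3 hα (by norm_num) (by norm_num)) hP
  rw [polyMod_2] at hdvd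
  rcases hirr.prime.dvd_or_dvd hdvd with h | h
  · have hQb : Qb = X := eq_of_monic_of_associated hmon monic_X (hirr.associated_of_dvd irreducible_X h)
    have hPeq := hspan X (by rw [hQb, Polynomial.map_X])
    rw [aeval_X, Nat.cast_ofNat, span_2_lin0_eq hα] at hPeq
    exact ⟨⟨-20 + 3 * thetaInt hα - 5 * thetaInt (delta_root hα), by rw [hPeq, Ideal.submodule_span_eq]⟩⟩
  · have hQb : Qb = X ^ 2 + X + 1 :=
      eq_of_monic_of_associated hmon (by monicity!) (hirr.associated_of_dvd CubicDisc307.irreducible_quad_two h)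
    have hPeq := hspan (X ^ 2 + X + 1) (by rw [hQb]; simp)
    rw [show aeval (thetaInt hα) (X ^ 2 + X + 1 : ℤ[X]) = thetaInt hα ^ 2 + thetaInt hα + 1 by
        simp only [map_add, map_pow, aeval_X, map_one], Nat.cast_ofNat, span_2_quad_eq hα] at hPeq
    exact ⟨⟨381 + 56 * thetaInt hα + 23 * thetaInt (delta_root hα), by rw [hPeq, Ideal.submodule_span_eq]⟩⟩

/-- **Every prime of `𝓞_F` above `3` is principal**: `3` is inert (`f` irreducible mod `3`, `3 ∤ exponent`), so `P = (3)`.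
[cite: Marcus2018, Ch. 3, Thm. 27] [cite: LMFDB, number field 3.1.18251.1 (class number 1)] -/
theorem isPrincipal_of_mem_primesOver_3 (h3 : finrank ℚ F = 3) (hα : aeval α (poly (-1) (-119) (-494)) = 0) {P : Ideal (𝓞 F)}
    (hP : P ∈ primesOver (span {((3 : ℕ) : ℤ)}) (𝓞 F)) : Submodule.IsPrincipal P := by
  have hPeq := eq_span_of_no_root' irreducible_polyQ hα (by norm_num : Nat.Prime 3)
    (not_dvd_exponent h3 hα (by norm_num) (by norm_num)) hP no_root_3
  exact ⟨⟨((3 : ℕ) : 𝓞 F), by rw [hPeq, Ideal.submodule_span_eq]⟩⟩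

/-- `f` has no root modulo `5`. [cite: Marcus2018, Ch. 3, Thm. 27] -/
theorem no_root_5' :
    ∀ r : ZMod 5, r ^ 3 + ((-1 : ℤ) : ZMod 5) * r ^ 2 + ((-119 : ℤ) : ZMod 5) * r + ((-494 : ℤ) : ZMod 5) ≠ 0 := by
  decide

/-- **Every prime of `𝓞_F` above `5` is principal**: `5` is inert (`f` irreducible mod `5`, `5 ∤ exponent`), so `P = (5)`.
[cite: Marcus2018, Ch. 3, Thm. 27] [cite: LMFDB, number field 3.1.18251.1 (class number 1)] -/
theorem isPrincipal_of_mem_primesOver_5 (h3 : finrank ℚ F = 3) (hα : aeval α (poly (-1) (-119) (-494)) = 0) {P : Ideal (𝓞 F)}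
    (hP : P ∈ primesOver (span {((5 : ℕ) : ℤ)}) (𝓞 F)) : Submodule.IsPrincipal P := by
  have hPeq := eq_span_of_no_root' irreducible_polyQ hα (by norm_num : Nat.Prime 5)
    (not_dvd_exponent h3 hα (by norm_num) (by norm_num)) hP no_root_5'
  exact ⟨⟨((5 : ℕ) : 𝓞 F), by rw [hPeq, Ideal.submodule_span_eq]⟩⟩

/-- `(7, δ + 4) = (-69 + 5 * θ + δ)`, an element of norm `7` (identities checked in `F`, `δ = (α ^ 2 - 5 * α - 78) / 7`).
[cite: Marcus2018, Ch. 3, Thm. 27] -/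
theorem span_7_dlin4_eq (hα : aeval α (poly (-1) (-119) (-494)) = 0) :
    span {(7 : 𝓞 F), thetaInt (delta_root hα) + 4} = span {-69 + 5 * thetaInt hα + thetaInt (delta_root hα)} := by
  apply le_antisymm
  · rw [span_le]
    rintro x hx
    rcases hx with rfl | hx
    · exact mem_span_singleton'.mpr ⟨3245 + 477 * thetaInt hα + 196 * thetaInt (delta_root hα), by
          rw [RingOfIntegers.ext_iff]
          simp only [map_mul, map_add, map_neg, map_ofNat, MonicCubic.thetaInt, RingOfIntegers.map_mk]
          linear_combination (((1205 : F) / 7) + ((4 : F)) * α) * cubic_eq hα⟩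
    · rw [Set.mem_singleton_iff.mp hx]
      exact mem_span_singleton'.mpr ⟨3626 + 533 * thetaInt hα + 219 * thetaInt (delta_root hα), by
          rw [RingOfIntegers.ext_iff]
          simp only [map_mul, map_add, map_neg, map_ofNat, MonicCubic.thetaInt, RingOfIntegers.map_mk]
          linear_combination (((9425 : F) / 49) + ((219 : F) / 49) * α) * cubic_eq hα⟩
  · rw [span_singleton_le_iff_mem, mem_span_pair]
    exact ⟨-69 - 478 * thetaInt hα - 116 * thetaInt (delta_root hα), -345 + 69 * thetaInt hα + 1434 * thetaInt (delta_root hα), by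
        rw [RingOfIntegers.ext_iff]
        simp only [map_mul, map_add, map_sub, map_neg, map_ofNat, MonicCubic.thetaInt, RingOfIntegers.map_mk]
        linear_combination (((-12423 : F) / 49) + ((1434 : F) / 49) * α) * cubic_eq hα⟩

/-- **Every prime of `𝓞_F` above `7` with `7^f ≤ 38` is principal** (Dedekind–Kummer through `δ`, `7 ∤ exponent`, with `polyModDelta_7` and the generators above).
[cite: Marcus2018, Ch. 3, Thm. 27] [cite: LMFDB, number field 3.1.18251.1 (class number 1)] -/
theorem isPrincipal_of_mem_primesOver_7 (h3 : finrank ℚ F = 3) (hα : aeval α (poly (-1) (-119) (-494)) = 0) {P : Ideal (𝓞 F)}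
    (hP : P ∈ primesOver (span {((7 : ℕ) : ℤ)}) (𝓞 F))
    (hle : 7 ^ P.inertiaDeg ℤ ≤ 38) : Submodule.IsPrincipal P := by
  haveI : Fact (Nat.Prime 7) := ⟨by norm_num⟩
  obtain ⟨Qb, hirr, hmon, hdvd, hdeg, hspan⟩ :=
    exists_factor_of_mem_primesOver' irreducible_polyQ_delta (delta_root hα) (by norm_num : Nat.Prime 7)
      (not_dvd_exponent_delta h3 hα (by norm_num) (by norm_num)) hP
  rw [polyModDelta_7] at hdvd
  rcases hirr.prime.dvd_or_dvd hdvd with h | h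
  · have hirr1 : Irreducible (X + 4 : (ZMod 7)[X]) := by
      rw [show (X + 4 : (ZMod 7)[X]) = X - C (-4) by rw [map_neg, map_ofNat]; ring]
      exact irreducible_X_sub_C _
    have hQb : Qb = X + 4 := eq_of_monic_of_associated hmon (by monicity!) (hirr.associated_of_dvd hirr1 h)
    have hPeq := hspan (X + C 4) (by rw [hQb]; simp [map_ofNat])
    rw [show aeval (thetaInt (delta_root hα)) (X + C 4 : ℤ[X]) = thetaInt (delta_root hα) + 4 by
        simp only [map_add, aeval_X, aeval_C, algebraMap_int_eq, Int.coe_castRingHom, Int.cast_ofNat], Nat.cast_ofNat, span_7_dlin4_eq hα] at hPeq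
    exact ⟨⟨-69 + 5 * thetaInt hα + thetaInt (delta_root hα), by rw [hPeq, Ideal.submodule_span_eq]⟩⟩
  · have hQb : Qb = X ^ 2 + 3 * X + 1 :=
      eq_of_monic_of_associated hmon (by monicity!) (hirr.associated_of_dvd irreducible_quad_7_delta h)
    exfalso
    have hd2 : (X ^ 2 + 3 * X + 1 : (ZMod 7)[X]).natDegree = 2 := by compute_degree!
    rw [hdeg, hQb, hd2] at hle
    norm_num at hle

/-- `f` has no root modulo `11`. [cite: Marcus2018, Ch. 3, Thm. 27] -/
theorem no_root_11' :
    ∀ r : ZMod 11, r ^ 3 + ((-1 : ℤ) : ZMod 11) * r ^ 2 + ((-119 : ℤ) : ZMod 11) * r + ((-494 : ℤ) : ZMod 11) ≠ 0 := by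
  decide

/-- **Every prime of `𝓞_F` above `11` is principal**: `11` is inert (`f` irreducible mod `11`, `11 ∤ exponent`), so `P = (11)`.
[cite: Marcus2018, Ch. 3, Thm. 27] [cite: LMFDB, number field 3.1.18251.1 (class number 1)] -/
theorem isPrincipal_of_mem_primesOver_11 (h3 : finrank ℚ F = 3) (hα : aeval α (poly (-1) (-119) (-494)) = 0) {P : Ideal (𝓞 F)}
    (hP : P ∈ primesOver (span {((11 : ℕ) : ℤ)}) (𝓞 F)) : Submodule.IsPrincipal P := by
  have hPeq := eq_span_of_no_root' irreducible_polyQ hα (by norm_num : Nat.Prime 11)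
    (not_dvd_exponent h3 hα (by norm_num) (by norm_num)) hP no_root_11'
  exact ⟨⟨((11 : ℕ) : 𝓞 F), by rw [hPeq, Ideal.submodule_span_eq]⟩⟩

/-- `(13, θ) = (-13 + θ)`, an element of norm `13` (identities checked in `F`, `δ = (α ^ 2 - 5 * α - 78) / 7`).
[cite: Marcus2018, Ch. 3, Thm. 27] -/
theorem span_13_lin0_eq (hα : aeval α (poly (-1) (-119) (-494)) = 0) :
    span {(13 : 𝓞 F), thetaInt hα} = span {-13 + thetaInt hα} := by
  apply le_antisymm
  · rw [span_le]
    rintro x hx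
    rcases hx with rfl | hx
    · exact mem_span_singleton'.mpr ⟨115 + 17 * thetaInt hα + 7 * thetaInt (delta_root hα), by
          rw [RingOfIntegers.ext_iff]
          simp only [map_mul, map_add, map_neg, map_ofNat, MonicCubic.thetaInt, RingOfIntegers.map_mk]
          linear_combination (((1 : F))) * cubic_eq hα⟩
    · rw [Set.mem_singleton_iff.mp hx]
      exact mem_span_singleton'.mpr ⟨116 + 17 * thetaInt hα + 7 * thetaInt (delta_root hα), by
          rw [RingOfIntegers.ext_iff]
          simp only [map_mul, map_add, map_neg, map_ofNat, MonicCubic.thetaInt, RingOfIntegers.map_mk]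
          linear_combination (((1 : F))) * cubic_eq hα⟩
  · rw [span_singleton_le_iff_mem, mem_span_pair]
    exact ⟨-1, 1, by
        rw [RingOfIntegers.ext_iff]
        simp only [map_mul, map_add, map_neg, map_ofNat, map_one, MonicCubic.thetaInt, RingOfIntegers.map_mk]
        linear_combination (0 : F) * cubic_eq hα⟩

/-- `(13, θ + 11) = (-49 + 2 * θ + 6 * δ)`, an element of norm `13` (identities checked in `F`, `δ = (α ^ 2 - 5 * α - 78) / 7`).
[cite: Marcus2018, Ch. 3, Thm. 27] -/
theorem span_13_lin11_eq (hα : aeval α (poly (-1) (-119) (-494)) = 0) :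
    span {(13 : 𝓞 F), thetaInt hα + 11} = span {-49 + 2 * thetaInt hα + 6 * thetaInt (delta_root hα)} := by
  apply le_antisymm
  · rw [span_le]
    rintro x hx
    rcases hx with rfl | hx
    · exact mem_span_singleton'.mpr ⟨1755 + 258 * thetaInt hα + 106 * thetaInt (delta_root hα), by
          rw [RingOfIntegers.ext_iff]
          simp only [map_mul, map_add, map_neg, map_ofNat, MonicCubic.thetaInt, RingOfIntegers.map_mk]
          linear_combination (((6596 : F) / 49) + ((636 : F) / 49) * α) * cubic_eq hα⟩
    · rw [Set.mem_singleton_iff.mp hx]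
      exact mem_span_singleton'.mpr ⟨3245 + 477 * thetaInt hα + 196 * thetaInt (delta_root hα), by
          rw [RingOfIntegers.ext_iff]
          simp only [map_mul, map_add, map_neg, map_ofNat, MonicCubic.thetaInt, RingOfIntegers.map_mk]
          linear_combination (((1742 : F) / 7) + ((24 : F)) * α) * cubic_eq hα⟩
  · rw [span_singleton_le_iff_mem, mem_span_pair]
    exact ⟨-3544 * thetaInt hα - 2120 * thetaInt (delta_root hα), -34211 + 5267 * thetaInt hα - 1329 * thetaInt (delta_root hα), by
        rw [RingOfIntegers.ext_iff]
        simp only [map_mul, map_add, map_sub, map_neg, map_ofNat, MonicCubic.thetaInt, RingOfIntegers.map_mk]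
        linear_combination (((-1329 : F) / 7)) * cubic_eq hα⟩

/-- `(13, θ + 1) = (-29 - θ + 11 * δ)`, an element of norm `13` (identities checked in `F`, `δ = (α ^ 2 - 5 * α - 78) / 7`).
[cite: Marcus2018, Ch. 3, Thm. 27] -/
theorem span_13_lin1_eq (hα : aeval α (poly (-1) (-119) (-494)) = 0) :
    span {(13 : 𝓞 F), thetaInt hα + 1} = span {-29 - thetaInt hα + 11 * thetaInt (delta_root hα)} := by
  apply le_antisymm
  · rw [span_le]
    rintro x hx
    rcases hx with rfl | hx
    · exact mem_span_singleton'.mpr ⟨1027 + 151 * thetaInt hα + 62 * thetaInt (delta_root hα), by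
          rw [RingOfIntegers.ext_iff]
          simp only [map_mul, map_add, map_sub, map_neg, map_ofNat, MonicCubic.thetaInt, RingOfIntegers.map_mk]
          linear_combination (((5055 : F) / 49) + ((682 : F) / 49) * α) * cubic_eq hα⟩
    · rw [Set.mem_singleton_iff.mp hx]
      exact mem_span_singleton'.mpr ⟨1109 + 163 * thetaInt hα + 67 * thetaInt (delta_root hα), by
          rw [RingOfIntegers.ext_iff]
          simp only [map_mul, map_add, map_sub, map_neg, map_ofNat, map_one, MonicCubic.thetaInt, RingOfIntegers.map_mk]
          linear_combination (((5449 : F) / 49) + ((737 : F) / 49) * α) * cubic_eq hα⟩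
  · rw [span_singleton_le_iff_mem, mem_span_pair]
    exact ⟨-196 * thetaInt hα - 25 * thetaInt (delta_root hα), 2883 - 112 * thetaInt (delta_root hα), by
        rw [RingOfIntegers.ext_iff]
        simp only [map_mul, map_add, map_sub, map_neg, map_ofNat, map_one, MonicCubic.thetaInt, RingOfIntegers.map_mk]
        linear_combination (((-16 : F))) * cubic_eq hα⟩

/-- **Every prime of `𝓞_F` above `13` is principal** (Dedekind–Kummer through `θ`, `13 ∤ exponent`, with `polyMod_13` and the generators above).
[cite: Marcus2018, Ch. 3, Thm. 27] [cite: LMFDB, number field 3.1.18251.1 (class number 1)] -/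
theorem isPrincipal_of_mem_primesOver_13 (h3 : finrank ℚ F = 3) (hα : aeval α (poly (-1) (-119) (-494)) = 0) {P : Ideal (𝓞 F)}
    (hP : P ∈ primesOver (span {((13 : ℕ) : ℤ)}) (𝓞 F)) : Submodule.IsPrincipal P := by
  haveI : Fact (Nat.Prime 13) := ⟨by norm_num⟩
  obtain ⟨Qb, hirr, hmon, hdvd, -, hspan⟩ :=
    exists_factor_of_mem_primesOver' irreducible_polyQ hα (by norm_num : Nat.Prime 13)
      (not_dvd_exponent h3 hα (by norm_num) (by norm_num)) hP
  rw [polyMod_13] at hdvd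
  rcases hirr.prime.dvd_or_dvd hdvd with h12 | h
  · rcases hirr.prime.dvd_or_dvd h12 with h | h
    · have hQb : Qb = X := eq_of_monic_of_associated hmon monic_X (hirr.associated_of_dvd irreducible_X h)
      have hPeq := hspan X (by rw [hQb, Polynomial.map_X])
      rw [aeval_X, Nat.cast_ofNat, span_13_lin0_eq hα] at hPeq
      exact ⟨⟨-13 + thetaInt hα, by rw [hPeq, Ideal.submodule_span_eq]⟩⟩
    · have hirr1 : Irreducible (X + 11 : (ZMod 13)[X]) := by
        rw [show (X + 11 : (ZMod 13)[X]) = X - C (-11) by rw [map_neg, map_ofNat]; ring]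
        exact irreducible_X_sub_C _
      have hQb : Qb = X + 11 := eq_of_monic_of_associated hmon (by monicity!) (hirr.associated_of_dvd hirr1 h)
      have hPeq := hspan (X + C 11) (by rw [hQb]; simp [map_ofNat])
      rw [show aeval (thetaInt hα) (X + C 11 : ℤ[X]) = thetaInt hα + 11 by
          simp only [map_add, aeval_X, aeval_C, algebraMap_int_eq, Int.coe_castRingHom, Int.cast_ofNat], Nat.cast_ofNat, span_13_lin11_eq hα] at hPeq
      exact ⟨⟨-49 + 2 * thetaInt hα + 6 * thetaInt (delta_root hα), by rw [hPeq, Ideal.submodule_span_eq]⟩⟩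
  · have hirr1 : Irreducible (X + 1 : (ZMod 13)[X]) := by
      rw [show (X + 1 : (ZMod 13)[X]) = X - C (-1) by rw [map_neg, map_one, sub_neg_eq_add]]
      exact irreducible_X_sub_C _
    have hQb : Qb = X + 1 := eq_of_monic_of_associated hmon (by monicity!) (hirr.associated_of_dvd hirr1 h)
    have hPeq := hspan (X + 1) (by rw [hQb]; simp)
    rw [show aeval (thetaInt hα) (X + 1 : ℤ[X]) = thetaInt hα + 1 by
        simp only [map_add, aeval_X, map_one], Nat.cast_ofNat, span_13_lin1_eq hα] at hPeq
    exact ⟨⟨-29 - thetaInt hα + 11 * thetaInt (delta_root hα), by rw [hPeq, Ideal.submodule_span_eq]⟩⟩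

end NumberField

end Literature.NumberTheory.CubicFields.CubicDisc18251

end
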